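import Summits.NavierStokesRegularity.NavierStokesRegularity.Theorems.TypeIIInviscidRelaxationOneSidedRadialCriterionOneThinCore
import Summits.NavierStokesRegularity.NavierStokesRegularity.Theorems.ScenarioCensusRowF5lgGate
import HarnessLib

/-!
# The one-sided radial criterion: a Type-I bound on the axial compression rate in ONE parabolic core suffices
# (ANY constants) — blow-up under the gate is Type II at the axis

Helper toward the crux `OneSidedRadialCriterion` (stmt-NavierStokesRegularity-19059, line `subcritical_core_reynolds`;
also the expired door `sub_typeI_core_compression`, whose stub `stub_subTypeICoreCompression` asked the strain bound
`u_r ≥ −κ r/(T−t)` for EVERY `ξ` and EVERY `κ`).  Consequences of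
`RadialInflowPlateau.hasSmoothExtensionPast_of_oneThinSubcriticalCore` (one thin subcritical core ⇒ continuation, any
gate constant):

* `hasSmoothExtensionPast_of_gate_typeICoreStrain` — in the standing class, under the gate `r u_r ≥ −Cν` on
  `{r < δ} × [0,T)` (ANY `C`): if for SOME `κ > 0`, SOME core width `ξ > 0` and SOME `T₁ < T` the radial compression
  rate is Type-I bounded in the parabolic core, `u_r ≥ −κ r/(T−t)` for `T₁ ≤ t < T`, `0 < r < δ`, `r < ξ√(ν(T−t))`,
  then `HasSmoothExtensionPast ν 0 u T`.  (Tree: `RadialInflowCoreStrain.oneSidedRadialCriterion_of_coreStrain_nearTop`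
  needed SPECIFIC small constants `ξ₀(C), κ₀(C)`; here both are arbitrary — an "any constant" Type-I criterion for one
  scalar, the radial compression rate at the axis, conditional on the one-sided gate.)
* `hasSmoothExtensionPast_of_gate_typeICoreGradient` — the same with the gradient: `‖∇u(t,x)‖ ≤ κ/(T−t)` at the core
  points (any `κ`, any `ξ`) ⇒ continuation (`|u_r| ≤ r‖∇u‖` for axisymmetric fields,
  `ScenarioCensus.LogGate.abs_radialVelocity_le_mul_norm_fderiv`);
* `typeII_coreStrain_of_blowup`, `typeII_coreGradient_of_blowup` — blow-up reading: under the gate (any `C`) a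
  solution that does NOT extend past `T` shows, for every `κ`, every `ξ > 0` and every `T₁ < T`, a time `t ∈ [T₁,T)`
  and a core point (`0 < r < δ`, `r < ξ√(ν(T−t))`) with `u_r < −κ r/(T−t)`, resp. `‖∇u(t,x)‖ > κ/(T−t)`:
  `limsup (T−t)·sup_core(−u_r/r) = +∞` — the axial compression is genuinely TYPE II, inside every parabolic core.

Honest label: CRITERIA and their contrapositive (comparison method).  Not proved: that the gate forces a Type-I
compression rate (that is the content of ⟨19059⟩ for `C ≥ 2`); nothing here proves `OneSidedRadialCriterion`,
`AxisymSwirlRegular` or NavierStokesRegularity. [new]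
-/

noncomputable section

set_option linter.dupNamespace false

open Set Real
open Literature.Analysis.FluidPDE

namespace Summit.NavierStokesRegularity.NavierStokesRegularity.Theorems.RadialInflowPlateau

open Summit.NavierStokesRegularity.NavierStokesRegularity.Theorems
open Summit.NavierStokesRegularity.NavierStokesRegularity.Theorems.ScenarioCensus.LogGate

/-- **Gate + Type-I radial compression rate in ONE parabolic core (any constants) ⇒ continuation.** [new] -/
theorem hasSmoothExtensionPast_of_gate_typeICoreStrain {ν T C δ : ℝ} (hν : 0 < ν) (hT : 0 < T) (hδ : 0 < δ)
    {u : ℝ → EuclideanSpace ℝ (Fin 3) → EuclideanSpace ℝ (Fin 3)} {p : ℝ → EuclideanSpace ℝ (Fin 3) → ℝ}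
    (hcl : IsClassicalNSSolutionOn (Ico 0 T) ν 0 u p) (hLH : IsLerayHopfOn T ν 0 (u 0) u)
    (hbd : ∀ T' < T, ∃ M : ℝ, ∀ t ∈ Icc 0 T', ∀ x, ‖u t x‖ ≤ M)
    (hax : ∀ t ∈ Ico 0 T, IsAxisymmetric (u t)) (hdec : HasRapidSpatialDecay (u 0))
    (hgate : ∀ t ∈ Ico 0 T, ∀ x : EuclideanSpace ℝ (Fin 3), cylRadius x < δ →
      -(C * ν) ≤ x 0 * u t x 0 + x 1 * u t x 1)
    (hstrain : ∃ κ ξ T₁ : ℝ, 0 < κ ∧ 0 < ξ ∧ T₁ < T ∧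
      ∀ t ∈ Ico 0 T, T₁ ≤ t → ∀ x : EuclideanSpace ℝ (Fin 3), 0 < cylRadius x → cylRadius x < δ →
        cylRadius x < ξ * √(ν * (T - t)) → -(κ * cylRadius x / (T - t)) ≤ radialVelocity (u t) x) :
    HasSmoothExtensionPast ν 0 u T := by
  obtain ⟨κ, ξ, T₁, hκ, hξ, hT₁, hstr⟩ := hstrain
  -- thin core width `ξ' = min ξ (1/(κ+1))`: there `κ r² < ν(T−t)`, so `u_r ≥ −κ r/(T−t) > −ν/r`
  set ξ' : ℝ := min ξ (1 / (κ + 1)) with hξ'_def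
  have hξ' : 0 < ξ' := lt_min hξ (by positivity)
  have hξ'ξ : ξ' ≤ ξ := min_le_left _ _
  have hξ'κ : κ * ξ' ^ 2 ≤ 1 := by
    have h1 : ξ' ≤ 1 / (κ + 1) := min_le_right _ _
    have h2 : 1 / (κ + 1) ≤ 1 := by rw [div_le_one (by positivity)]; linarith
    have h3 : ξ' ^ 2 ≤ ξ' * (1 / (κ + 1)) := by rw [sq]; exact mul_le_mul_of_nonneg_left h1 hξ'.le
    have h4 : ξ' * (1 / (κ + 1)) ≤ 1 / (κ + 1) := by
      calc ξ' * (1 / (κ + 1)) ≤ 1 * (1 / (κ + 1)) := mul_le_mul_of_nonneg_right (h1.trans h2) (by positivity)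
        _ = 1 / (κ + 1) := one_mul _
    have h5 : κ * (1 / (κ + 1)) ≤ 1 := by
      rw [mul_one_div, div_le_one (by positivity)]; linarith
    nlinarith [h3.trans h4]
  refine hasSmoothExtensionPast_of_oneThinSubcriticalCore hν hT hδ hcl hLH hbd hax hdec hgate
    ⟨1, ξ', T₁, one_pos, by norm_num, hξ', hT₁, fun t ht htT₁ x hx hxδ hxcore => ?_⟩
  have hTt : 0 < T - t := by linarith [ht.2]
  have hcore : cylRadius x < ξ * √(ν * (T - t)) :=
    hxcore.trans_le (mul_le_mul_of_nonneg_right hξ'ξ (Real.sqrt_nonneg _))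
  have h1 := hstr t ht htT₁ x hx hxδ hcore
  -- `κ r² ≤ ν (T−t)` from `r < ξ'√(ν(T−t))` and `κ ξ'² ≤ 1`
  have hr2 : κ * cylRadius x ^ 2 ≤ ν * (T - t) := by
    have hs : cylRadius x ^ 2 ≤ ξ' ^ 2 * (ν * (T - t)) := by
      have h := pow_le_pow_left₀ (cylRadius_nonneg x) hxcore.le 2
      rwa [mul_pow, Real.sq_sqrt (by positivity)] at h
    calc κ * cylRadius x ^ 2 ≤ κ * (ξ' ^ 2 * (ν * (T - t))) := mul_le_mul_of_nonneg_left hs hκ.le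
      _ = (κ * ξ' ^ 2) * (ν * (T - t)) := by ring
      _ ≤ 1 * (ν * (T - t)) := mul_le_mul_of_nonneg_right hξ'κ (by positivity)
      _ = ν * (T - t) := one_mul _
  have h2 : -(ν * 1 / cylRadius x) ≤ -(κ * cylRadius x / (T - t)) := by
    rw [neg_le_neg_iff, div_le_div_iff₀ hTt hx]
    nlinarith
  exact h2.trans h1

/-- **Gate + Type-I GRADIENT bound in ONE parabolic core (any constants) ⇒ continuation.** [new] -/
theorem hasSmoothExtensionPast_of_gate_typeICoreGradient {ν T C δ : ℝ} (hν : 0 < ν) (hT : 0 < T) (hδ : 0 < δ)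
    {u : ℝ → EuclideanSpace ℝ (Fin 3) → EuclideanSpace ℝ (Fin 3)} {p : ℝ → EuclideanSpace ℝ (Fin 3) → ℝ}
    (hcl : IsClassicalNSSolutionOn (Ico 0 T) ν 0 u p) (hLH : IsLerayHopfOn T ν 0 (u 0) u)
    (hbd : ∀ T' < T, ∃ M : ℝ, ∀ t ∈ Icc 0 T', ∀ x, ‖u t x‖ ≤ M)
    (hax : ∀ t ∈ Ico 0 T, IsAxisymmetric (u t)) (hdec : HasRapidSpatialDecay (u 0))
    (hgate : ∀ t ∈ Ico 0 T, ∀ x : EuclideanSpace ℝ (Fin 3), cylRadius x < δ →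
      -(C * ν) ≤ x 0 * u t x 0 + x 1 * u t x 1)
    (hgrad : ∃ κ ξ T₁ : ℝ, 0 < κ ∧ 0 < ξ ∧ T₁ < T ∧
      ∀ t ∈ Ico 0 T, T₁ ≤ t → ∀ x : EuclideanSpace ℝ (Fin 3), 0 < cylRadius x → cylRadius x < δ →
        cylRadius x < ξ * √(ν * (T - t)) → ‖fderiv ℝ (u t) x‖ ≤ κ / (T - t)) :
    HasSmoothExtensionPast ν 0 u T := by
  obtain ⟨κ, ξ, T₁, hκ, hξ, hT₁, hgr⟩ := hgrad
  refine hasSmoothExtensionPast_of_gate_typeICoreStrain hν hT hδ hcl hLH hbd hax hdec hgate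
    ⟨κ, ξ, T₁, hκ, hξ, hT₁, fun t ht htT₁ x hx hxδ hxcore => ?_⟩
  have hTt : 0 < T - t := by linarith [ht.2]
  have hd : DifferentiableAt ℝ (u t) x := ((hcl.contDiff_velocity ht).differentiable (by simp)).differentiableAt
  have h1 : |radialVelocity (u t) x| ≤ cylRadius x * ‖fderiv ℝ (u t) x‖ :=
    abs_radialVelocity_le_mul_norm_fderiv (hax t ht) hd
  have h2 : cylRadius x * ‖fderiv ℝ (u t) x‖ ≤ κ * cylRadius x / (T - t) := by
    rw [mul_comm κ, mul_div_assoc]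
    exact mul_le_mul_of_nonneg_left (hgr t ht htT₁ x hx hxδ hxcore) (cylRadius_nonneg x)
  have h3 := neg_abs_le (radialVelocity (u t) x)
  linarith

/-- **Blow-up under the gate is TYPE II in the radial compression rate, inside every parabolic core.** [new] -/
theorem typeII_coreStrain_of_blowup {ν T C δ : ℝ} (hν : 0 < ν) (hT : 0 < T) (hδ : 0 < δ)
    {u : ℝ → EuclideanSpace ℝ (Fin 3) → EuclideanSpace ℝ (Fin 3)} {p : ℝ → EuclideanSpace ℝ (Fin 3) → ℝ}
    (hcl : IsClassicalNSSolutionOn (Ico 0 T) ν 0 u p) (hLH : IsLerayHopfOn T ν 0 (u 0) u)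
    (hbd : ∀ T' < T, ∃ M : ℝ, ∀ t ∈ Icc 0 T', ∀ x, ‖u t x‖ ≤ M)
    (hax : ∀ t ∈ Ico 0 T, IsAxisymmetric (u t)) (hdec : HasRapidSpatialDecay (u 0))
    (hgate : ∀ t ∈ Ico 0 T, ∀ x : EuclideanSpace ℝ (Fin 3), cylRadius x < δ →
      -(C * ν) ≤ x 0 * u t x 0 + x 1 * u t x 1)
    (hsing : ¬ HasSmoothExtensionPast ν 0 u T) {κ ξ T₁ : ℝ} (hκ : 0 < κ) (hξ : 0 < ξ) (hT₁ : T₁ < T) :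
    ∃ t ∈ Ico 0 T, T₁ ≤ t ∧ ∃ x : EuclideanSpace ℝ (Fin 3), 0 < cylRadius x ∧ cylRadius x < δ ∧
      cylRadius x < ξ * √(ν * (T - t)) ∧ radialVelocity (u t) x < -(κ * cylRadius x / (T - t)) := by
  by_contra h
  push Not at h
  exact hsing (hasSmoothExtensionPast_of_gate_typeICoreStrain hν hT hδ hcl hLH hbd hax hdec hgate
    ⟨κ, ξ, T₁, hκ, hξ, hT₁, fun t ht htT₁ x hx hxδ hxcore => h t ht htT₁ x hx hxδ hxcore⟩)

/-- **Blow-up under the gate is TYPE II in the gradient, inside every parabolic core.** [new] -/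
theorem typeII_coreGradient_of_blowup {ν T C δ : ℝ} (hν : 0 < ν) (hT : 0 < T) (hδ : 0 < δ)
    {u : ℝ → EuclideanSpace ℝ (Fin 3) → EuclideanSpace ℝ (Fin 3)} {p : ℝ → EuclideanSpace ℝ (Fin 3) → ℝ}
    (hcl : IsClassicalNSSolutionOn (Ico 0 T) ν 0 u p) (hLH : IsLerayHopfOn T ν 0 (u 0) u)
    (hbd : ∀ T' < T, ∃ M : ℝ, ∀ t ∈ Icc 0 T', ∀ x, ‖u t x‖ ≤ M)
    (hax : ∀ t ∈ Ico 0 T, IsAxisymmetric (u t)) (hdec : HasRapidSpatialDecay (u 0))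
    (hgate : ∀ t ∈ Ico 0 T, ∀ x : EuclideanSpace ℝ (Fin 3), cylRadius x < δ →
      -(C * ν) ≤ x 0 * u t x 0 + x 1 * u t x 1)
    (hsing : ¬ HasSmoothExtensionPast ν 0 u T) {κ ξ T₁ : ℝ} (hκ : 0 < κ) (hξ : 0 < ξ) (hT₁ : T₁ < T) :
    ∃ t ∈ Ico 0 T, T₁ ≤ t ∧ ∃ x : EuclideanSpace ℝ (Fin 3), 0 < cylRadius x ∧ cylRadius x < δ ∧
      cylRadius x < ξ * √(ν * (T - t)) ∧ κ / (T - t) < ‖fderiv ℝ (u t) x‖ := by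
  by_contra h
  push Not at h
  exact hsing (hasSmoothExtensionPast_of_gate_typeICoreGradient hν hT hδ hcl hLH hbd hax hdec hgate
    ⟨κ, ξ, T₁, hκ, hξ, hT₁, fun t ht htT₁ x hx hxδ hxcore => h t ht htT₁ x hx hxδ hxcore⟩)

end Summit.NavierStokesRegularity.NavierStokesRegularity.Theorems.RadialInflowPlateau

end
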